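import Mathlib
import Summits.ResolutionOfSingularities.ResolutionOfSingularities.Theorems.RadicialJungCleanModelsContactChainExit
import Summits.ResolutionOfSingularities.ResolutionOfSingularities.Theorems.RadicialJungCleanModelsContactNormalForm
import HarnessLib

/-!
# Route `RadicialJung`, crux `CleanModels` (stmt-ResolutionOfSingularities-15917), line `Sketch` rev 35, stub 6 `stub_cleanProp44` (X44c),
# work plan O8 / L7b: from a loose clean form (1) at a point of the curve to the ADAPTED presentation, and the exit

Memo `Cruxes/CleanModels/Lines/Sketch-memo-hand2-g8-stubs-5-7.md` §2 (G).  The hypothesis of X44c at a point `y` of a curve `Y` to be blown up is the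
anonymous `CleanRegAt`; in loose clean form (1) it provides a regular system of parameters `t` of `𝒪_{X,y}` and a representative
`u · ∏_{i<m} t_i^{a_i}` with every `a_i` prime to `p`.  The chain theorems (✓ p812153 / p812266 / p812309) consume instead a presentation ADAPTED to
the curve: a pair generating `𝓘_{Y,y}` and transversal members in contact normal form.  This file is the (mechanical) passage:

* `adapted_presentation_of_mem` — if ONE of the used components `s_{i₀}` (`s = t ∘ castLE`) lies in `𝓘_{Y,y}`: a pair `(tp₀,tp₁)`, part of a
  regular system of parameters and generating `𝓘_{Y,y}`, exponents `α` with `α₀ = a_{i₀}`, and contact normal forms `γ_i w^{k_i} + π_i` with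
  exponents `b_i` for the remaining members, with `u · ∏ s_i^{a_i} = u · ∏_j tp_j^{α_j} · ∏_i (γ_i w^{k_i} + π_i)^{b_i}`.  (Either a second used
  component lies in `𝓘_{Y,y}` — then the two generate it, and no third one does, by minimality of regular parameters — or `s_{i₀}` is completed
  to a generating pair by `exists_isRsopPart_append_span_eq`; the counting `dim 𝒪/𝓘 + #pair = 3` fixes the length.)
* `adapted_presentation_of_not_mem` — if NO used component lies in `𝓘_{Y,y}`: all members in contact normal form, the pair is any generating
  rsop pair with exponents `0`.
* `exists_pointChain_cleanPermissibleAt_of_looseCleanForm_mem` — **exit**: in the first case, for a closed point `y` of a regular curve on a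
  regular integral `X₀` (`dim 𝒪_{X₀,y} = 3`), there is a dominant chain of point blowing ups following the curve at whose end the line of
  `σ^♯G` is clean-permissible for the strict transform (✓ `exists_pointChain_cleanPermissibleAt` with `p ∤ α₀ = a_{i₀}`).
* `exists_pointChain_cleanPermissibleAt_or_uncharged_of_looseCleanForm` — in general: that exit, OR all used components are transversal with
  contacts `k_i` and `p ∣ Σ_i k_i a_i` (the uncharged configuration of the memo's (T1)/(T2)).

Honest framing: OURS (bookkeeping over Matsumura 14.2); nothing here proves resolution in characteristic `p`, X44c, or any case of `CleanModels`.
-/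

noncomputable section

set_option linter.dupNamespace false -- mandated namespace of this single-conjunct summit

open CategoryTheory AlgebraicGeometry TopologicalSpace IsLocalRing
open Literature.AlgebraicGeometry.Resolution Literature.AlgebraicGeometry.Motives
open Scheme.IdealSheafData

universe u

namespace Summit.ResolutionOfSingularities.ResolutionOfSingularities.Theorems.RadicialJung.CleanModels

section LocalAlgebra

variable {A : Type u} [CommRing A] [IsRegularLocalRing A]

/-- The range of an appended family (local copy of `range_fin_append`). [folklore] -/
private theorem range_append' {α : Type*} {m n : ℕ} (u : Fin m → α) (v : Fin n → α) :
    Set.range (Fin.append u v) = Set.range u ∪ Set.range v := by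
  ext a
  constructor
  · rintro ⟨i, rfl⟩
    induction i using Fin.addCases with
    | left j => exact Or.inl ⟨j, by simp⟩
    | right k => exact Or.inr ⟨k, by simp⟩
  · rintro (⟨j, rfl⟩ | ⟨k, rfl⟩)
    · exact ⟨Fin.castAdd n j, by simp⟩
    · exact ⟨Fin.natAdd m k, by simp⟩

/-- The length of a part of a regular system of parameters generating `P` is `dim A − dim A/P`; here: a family generating the ideal
of a curve (`dim A/P = 1`) in dimension three has length two. [cite: Matsumura1987, Thm. 14.2] -/
theorem length_eq_two_of_isRsopPart_span_eq {q : ℕ} {z : Fin q → A} (hz : IsRsopPart z) {P : Ideal A}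
    (hzP : Ideal.span (Set.range z) = P) (hP1 : ringKrullDim (A ⧸ P) = 1) (h3 : ringKrullDim A = 3) : q = 2 := by
  have h := hz.ringKrullDim_quotient_add
  rw [hzP, hP1, h3] at h
  have : 1 + q = 3 := by exact_mod_cast h
  omega

/-- **Adapted presentation, a used component inside the curve ideal.**  See the module docstring. [cite: Matsumura1987, Thm. 14.2] -/
theorem adapted_presentation_of_mem (P : Ideal A) [IsRegularLocalRing (A ⧸ P)] (hP1 : ringKrullDim (A ⧸ P) = 1)
    (h3 : ringKrullDim A = 3) (w : A) (hw : P ⊔ Ideal.span {w} = maximalIdeal A)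
    {m : ℕ} (s : Fin m → A) (hs : IsRsopPart s) (a : Fin m → ℕ) {i₀ : Fin m} (hi₀ : s i₀ ∈ P) :
    ∃ (tp : Fin 2 → A) (α : Fin 2 → ℕ) (γ π : Fin m → A) (k b : Fin m → ℕ),
      IsRsopPart tp ∧ Ideal.span (Set.range tp) = P ∧ α 0 = a i₀ ∧ (∀ i, IsUnit (γ i)) ∧ (∀ i, π i ∈ P) ∧
      (∏ i, s i ^ a i) = (∏ j, tp j ^ α j) * ∏ i, (γ i * w ^ k i + π i) ^ b i := by
  classical
  have hPm : P ≤ maximalIdeal A := le_sup_left.trans hw.le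
  -- contact normal forms for the members outside `P`
  have hnf : ∀ i, ∃ (k : ℕ) (γ π : A), IsUnit γ ∧ π ∈ P ∧ (s i ∉ P → s i = γ * w ^ k + π) := by
    intro i
    by_cases hi : s i ∈ P
    · exact ⟨0, 1, 0, isUnit_one, P.zero_mem, fun h => absurd hi h⟩
    · obtain ⟨k, γ, π, hγ, hπ, hs⟩ := exists_contact_normalForm P w hw (s i) hi
      exact ⟨k, γ, π, hγ, hπ, fun _ => hs⟩
  choose k γ π hγ hπ hnf using hnf
  by_cases hA : ∃ i₁, i₁ ≠ i₀ ∧ s i₁ ∈ P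
  · -- two used components inside `P`: they generate it
    obtain ⟨i₁, hi₁, hi₁P⟩ := hA
    let ι : Fin 2 → Fin m := ![i₀, i₁]
    have hι : Function.Injective ι := by
      intro x y hxy
      fin_cases x <;> fin_cases y
      · rfl
      · exact absurd hxy.symm (by simpa [ι] using hi₁)
      · exact absurd hxy (by simpa [ι] using hi₁)
      · rfl
    have hpair : IsRsopPart (s ∘ ι) := hs.comp ι hι
    have hpairP : ∀ j, (s ∘ ι) j ∈ P := fun j => by fin_cases j <;> simp [ι, hi₀, hi₁P]
    -- complete (trivially) to generators of `P` and count
    haveI : IsLocalRing (A ⧸ P) := inferInstance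
    have hb0 : IsRsopPart (Ideal.Quotient.mk P ∘ (Fin.elim0 : Fin 0 → A)) :=
      ⟨inferInstance, (maximalIdeal (A ⧸ P)).spanFinrank, Classical.choose (exists_regularSystemOfParameters (R := A ⧸ P)), by
        rw [zero_add]; exact (IsRegularLocalRing.spanFinrank_maximalIdeal (R := A ⧸ P)).symm, by
        rw [show Set.range (Ideal.Quotient.mk P ∘ (Fin.elim0 : Fin 0 → A)) = ∅ from Set.range_eq_empty _, Set.empty_union]
        exact Classical.choose_spec (exists_regularSystemOfParameters (R := A ⧸ P))⟩
    obtain ⟨r, c, -, hrsop, hspan⟩ := exists_isRsopPart_append_span_eq (J := P) hpair hpairP (fun l => Fin.elim0 l) hb0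
    have hlen := length_eq_two_of_isRsopPart_span_eq (hrsop.append_left) hspan hP1 h3
    have hr0 : r = 0 := by omega
    subst hr0
    have hspan' : Ideal.span (Set.range (s ∘ ι)) = P := by
      rw [← hspan, range_append', Set.range_eq_empty c, Set.union_empty]
    -- no third used component lies in `P`
    have hothers : ∀ i, i ≠ i₀ → i ≠ i₁ → s i ∉ P := by
      intro i h0 h1 hiP
      have hnot := hs.not_mem_span_image (S := {i₀, i₁}) (i := i) (by simp [h0, h1])
      apply hnot
      have : s '' {i₀, i₁} = Set.range (s ∘ ι) := by
        ext y; simp only [Set.mem_image, Set.mem_insert_iff, Set.mem_singleton_iff, Set.mem_range, Function.comp_apply, ι]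
        constructor
        · rintro ⟨l, (rfl | rfl), rfl⟩; exacts [⟨0, by simp⟩, ⟨1, by simp⟩]
        · rintro ⟨l, rfl⟩; fin_cases l; exacts [⟨i₀, Or.inl rfl, by simp⟩, ⟨i₁, Or.inr rfl, by simp⟩]
      rw [this, hspan']
      exact hiP
    refine ⟨s ∘ ι, ![a i₀, a i₁], γ, π, k, fun i => if i = i₀ ∨ i = i₁ then 0 else a i, hpair, hspan', by simp, hγ, hπ, ?_⟩
    -- the product identity
    have hsplit : ∀ i, s i ^ a i =
        (if i = i₀ ∨ i = i₁ then s i ^ a i else 1) * (γ i * w ^ k i + π i) ^ (if i = i₀ ∨ i = i₁ then 0 else a i) := by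
      intro i
      by_cases h : i = i₀ ∨ i = i₁
      · simp [h]
      · have h' : s i ∉ P := hothers i (fun e => h (Or.inl e)) (fun e => h (Or.inr e))
        rw [if_neg h, if_neg h, one_mul, ← hnf i h']
    rw [Finset.prod_congr rfl fun i _ => hsplit i, Finset.prod_mul_distrib]
    congr 1
    rw [Finset.prod_ite, Finset.prod_const_one, mul_one]
    have hfilter : Finset.univ.filter (fun i => i = i₀ ∨ i = i₁) = {i₀, i₁} := by
      ext i; simp
    rw [hfilter, Finset.prod_pair hi₁.symm, Fin.prod_univ_two]
    simp [ι]
  · -- only `s i₀` inside `P`: complete it to a generating pair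
    push Not at hA
    have hothers : ∀ i, i ≠ i₀ → s i ∉ P := fun i h => hA i h
    have hone : IsRsopPart (s ∘ ![i₀]) := hs.comp ![i₀] (fun x y _ => by fin_cases x; fin_cases y; rfl)
    have honeP : ∀ j, (s ∘ ![i₀]) j ∈ P := fun j => by fin_cases j; simpa using hi₀
    haveI : IsLocalRing (A ⧸ P) := inferInstance
    have hb0 : IsRsopPart (Ideal.Quotient.mk P ∘ (Fin.elim0 : Fin 0 → A)) :=
      ⟨inferInstance, (maximalIdeal (A ⧸ P)).spanFinrank, Classical.choose (exists_regularSystemOfParameters (R := A ⧸ P)), by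
        rw [zero_add]; exact (IsRegularLocalRing.spanFinrank_maximalIdeal (R := A ⧸ P)).symm, by
        rw [show Set.range (Ideal.Quotient.mk P ∘ (Fin.elim0 : Fin 0 → A)) = ∅ from Set.range_eq_empty _, Set.empty_union]
        exact Classical.choose_spec (exists_regularSystemOfParameters (R := A ⧸ P))⟩
    obtain ⟨r, c, -, hrsop, hspan⟩ := exists_isRsopPart_append_span_eq (J := P) hone honeP (fun l => Fin.elim0 l) hb0
    have hlen := length_eq_two_of_isRsopPart_span_eq (hrsop.append_left) hspan hP1 h3
    have hr1 : r = 1 := by omega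
    subst hr1
    -- the pair `(s i₀, c 0)`
    set tp : Fin 2 → A := Fin.append (s ∘ ![i₀]) c with htp
    have htp0 : tp 0 = s i₀ := by
      rw [htp, show (0 : Fin 2) = Fin.castAdd 1 (0 : Fin 1) from rfl, Fin.append_left]; rfl
    refine ⟨tp, ![a i₀, 0], γ, π, k, fun i => if i = i₀ then 0 else a i, hrsop.append_left, hspan, by simp, hγ, hπ, ?_⟩
    have hsplit : ∀ i, s i ^ a i =
        (if i = i₀ then s i ^ a i else 1) * (γ i * w ^ k i + π i) ^ (if i = i₀ then 0 else a i) := by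
      intro i
      by_cases h : i = i₀
      · simp [h]
      · rw [if_neg h, if_neg h, one_mul, ← hnf i (hothers i h)]
    rw [Finset.prod_congr rfl fun i _ => hsplit i, Finset.prod_mul_distrib]
    congr 1
    rw [Finset.prod_ite_eq' Finset.univ i₀ (fun i => s i ^ a i), if_pos (Finset.mem_univ _), Fin.prod_univ_two, htp0]
    simp

/-- **Adapted presentation, no used component inside the curve ideal**: all members are transversal, in contact normal form.
[cite: Matsumura1987, Thm. 14.2] -/
theorem adapted_presentation_of_not_mem (P : Ideal A) (w : A) (hw : P ⊔ Ideal.span {w} = maximalIdeal A)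
    {m : ℕ} (s : Fin m → A) (hsP : ∀ i, s i ∉ P) :
    ∃ (γ π : Fin m → A) (k : Fin m → ℕ), (∀ i, IsUnit (γ i)) ∧ (∀ i, π i ∈ P) ∧ ∀ i, s i = γ i * w ^ k i + π i := by
  have hnf : ∀ i, ∃ (k : ℕ) (γ π : A), IsUnit γ ∧ π ∈ P ∧ s i = γ * w ^ k + π := fun i =>
    exists_contact_normalForm P w hw (s i) (hsP i)
  choose k γ π hγ hπ hs using hnf
  exact ⟨γ, π, k, hγ, hπ, hs⟩

end LocalAlgebra

/-- **L7b exit from a loose clean form (1) with a used component inside the curve ideal.**  See the module docstring.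
[cite: CossartJannsenSaito2020, proof of Thm. 6.28, Step 5] [cite: CossartPiltant2008, Prop. 4.4 (proof, p. 10)] -/
theorem exists_pointChain_cleanPermissibleAt_of_looseCleanForm_mem {X₀ : Scheme.{u}} [IsIntegral X₀] [IsLocallyNoetherian X₀]
    (hX₀ : Scheme.IsRegular X₀) {C₀ : Closeds X₀}
    (hC₀reg : ∀ y ∈ (C₀ : Set X₀), ∃ c : Fin 2 → X₀.presheaf.stalk y,
      IsRsopPart c ∧ Ideal.span (Set.range c) = stalkIdeal (vanishingIdeal C₀) y)
    {x₀ : X₀} (hx₀ : IsClosed ({x₀} : Set X₀)) (hx₀C : x₀ ∈ (C₀ : Set X₀)) (hdim₀ : ringKrullDim (X₀.presheaf.stalk x₀) = 3)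
    (p : ℕ) (G : X₀.functionField) (cc : Fin p → X₀.functionField) (hcc : ∃ j : Fin p, (j : ℕ) ≠ 0 ∧ cc j ≠ 0)
    (w : X₀.presheaf.stalk x₀) (hw : stalkIdeal (vanishingIdeal C₀) x₀ ⊔ Ideal.span {w} = maximalIdeal _)
    {m : ℕ} (s : Fin m → X₀.presheaf.stalk x₀) (hs : IsRsopPart s) (a : Fin m → ℕ) (u : X₀.presheaf.stalk x₀) (hu : IsUnit u)
    (hX : (∑ j : Fin p, cc j ^ p * G ^ (j : ℕ)) = RatFn.toFunctionField x₀ (u * ∏ i, s i ^ a i))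
    {i₀ : Fin m} (hi₀ : s i₀ ∈ stalkIdeal (vanishingIdeal C₀) x₀) (ha : ¬ p ∣ a i₀) :
    ∃ (X : Scheme.{u}) (_ : IsIntegral X) (_ : IsLocallyNoetherian X) (σ : X ⟶ X₀) (_ : IsDominant σ) (C : Closeds X) (x : X) (n : ℕ),
      IsPointChainAlong σ C₀ C x n ∧ σ x = x₀ ∧ IsClosed ({x} : Set X) ∧
      CleanPermissibleAt p (RatFn.toFunctionField x) (RatFn.functionFieldMap σ G) (stalkIdeal (vanishingIdeal C) x) := by
  haveI : IsRegularLocalRing (X₀.presheaf.stalk x₀) := hX₀ x₀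
  obtain ⟨c2, hc2, hc2P⟩ := hC₀reg x₀ hx₀C
  haveI : IsRegularLocalRing (X₀.presheaf.stalk x₀ ⧸ stalkIdeal (vanishingIdeal C₀) x₀) := by
    rw [← hc2P]; exact hc2.isRegularLocalRing_quotient
  have hP1 : ringKrullDim (X₀.presheaf.stalk x₀ ⧸ stalkIdeal (vanishingIdeal C₀) x₀) = 1 := by
    rw [← hc2P]; exact ringKrullDim_quotient_span_pair_eq_one hc2 hdim₀
  obtain ⟨tp, α, γ, π, k, b, htp, htpP, hα0, hγ, hπ, hprod⟩ :=
    adapted_presentation_of_mem (stalkIdeal (vanishingIdeal C₀) x₀) hP1 hdim₀ w hw s hs a hi₀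
  have hX' : (∑ j : Fin p, cc j ^ p * G ^ (j : ℕ)) =
      RatFn.toFunctionField x₀ (u * (∏ j, tp j ^ α j) * ∏ i, (γ i * w ^ k i + π i) ^ b i) := by
    rw [hX, hprod, mul_assoc]
  obtain ⟨X, hXi, hXn, σ, hσ, C, x, hchain, hσx, hxcl, hclean⟩ :=
    exists_pointChain_cleanPermissibleAt hX₀ hC₀reg hx₀ hx₀C hdim₀ p G cc hcc w u hw hu tp htp htpP α γ π hγ hπ k b
      (Or.inl ⟨0, by rw [hα0]; exact ha⟩) hX'
  exact ⟨X, hXi, hXn, σ, hσ, C, x, _, hchain, hσx, hxcl, hclean⟩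

/-- **L7b from a loose clean form (1): exit, or the uncharged transversal configuration.**  See the module docstring.
[cite: CossartJannsenSaito2020, proof of Thm. 6.28, Step 5] [cite: CossartPiltant2008, Prop. 4.4 (proof, p. 10)] -/
theorem exists_pointChain_cleanPermissibleAt_or_uncharged_of_looseCleanForm {X₀ : Scheme.{u}} [IsIntegral X₀] [IsLocallyNoetherian X₀]
    (hX₀ : Scheme.IsRegular X₀) {C₀ : Closeds X₀}
    (hC₀reg : ∀ y ∈ (C₀ : Set X₀), ∃ c : Fin 2 → X₀.presheaf.stalk y,
      IsRsopPart c ∧ Ideal.span (Set.range c) = stalkIdeal (vanishingIdeal C₀) y)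
    {x₀ : X₀} (hx₀ : IsClosed ({x₀} : Set X₀)) (hx₀C : x₀ ∈ (C₀ : Set X₀)) (hdim₀ : ringKrullDim (X₀.presheaf.stalk x₀) = 3)
    (p : ℕ) (G : X₀.functionField) (cc : Fin p → X₀.functionField) (hcc : ∃ j : Fin p, (j : ℕ) ≠ 0 ∧ cc j ≠ 0)
    (w : X₀.presheaf.stalk x₀) (hw : stalkIdeal (vanishingIdeal C₀) x₀ ⊔ Ideal.span {w} = maximalIdeal _)
    {m : ℕ} (s : Fin m → X₀.presheaf.stalk x₀) (hs : IsRsopPart s) (a : Fin m → ℕ) (ha : ∀ i, ¬ p ∣ a i)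
    (u : X₀.presheaf.stalk x₀) (hu : IsUnit u)
    (hX : (∑ j : Fin p, cc j ^ p * G ^ (j : ℕ)) = RatFn.toFunctionField x₀ (u * ∏ i, s i ^ a i)) :
    (∃ (X : Scheme.{u}) (_ : IsIntegral X) (_ : IsLocallyNoetherian X) (σ : X ⟶ X₀) (_ : IsDominant σ) (C : Closeds X) (x : X)
        (n : ℕ), IsPointChainAlong σ C₀ C x n ∧ σ x = x₀ ∧ IsClosed ({x} : Set X) ∧
        CleanPermissibleAt p (RatFn.toFunctionField x) (RatFn.functionFieldMap σ G) (stalkIdeal (vanishingIdeal C) x)) ∨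
      ((∀ i, s i ∉ stalkIdeal (vanishingIdeal C₀) x₀) ∧
        ∃ (γ π : Fin m → X₀.presheaf.stalk x₀) (k : Fin m → ℕ), (∀ i, IsUnit (γ i)) ∧
          (∀ i, π i ∈ stalkIdeal (vanishingIdeal C₀) x₀) ∧ (∀ i, s i = γ i * w ^ k i + π i) ∧ p ∣ ∑ i, k i * a i) := by
  classical
  by_cases hmem : ∃ i₀, s i₀ ∈ stalkIdeal (vanishingIdeal C₀) x₀
  · obtain ⟨i₀, hi₀⟩ := hmem
    exact Or.inl (exists_pointChain_cleanPermissibleAt_of_looseCleanForm_mem hX₀ hC₀reg hx₀ hx₀C hdim₀ p G cc hcc w hw s hs a u hu hX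
      hi₀ (ha i₀))
  push Not at hmem
  haveI : IsRegularLocalRing (X₀.presheaf.stalk x₀) := hX₀ x₀
  obtain ⟨γ, π, k, hγ, hπ, hsk⟩ := adapted_presentation_of_not_mem (stalkIdeal (vanishingIdeal C₀) x₀) w hw s hmem
  by_cases hdiv : p ∣ ∑ i, k i * a i
  · exact Or.inr ⟨hmem, γ, π, k, hγ, hπ, hsk, hdiv⟩
  · left
    obtain ⟨c2, hc2, hc2P⟩ := hC₀reg x₀ hx₀C
    have hX' : (∑ j : Fin p, cc j ^ p * G ^ (j : ℕ)) =
        RatFn.toFunctionField x₀ (u * (∏ j, c2 j ^ (0 : Fin 2 → ℕ) j) * ∏ i, (γ i * w ^ k i + π i) ^ a i) := by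
      rw [hX]
      congr 1
      simp only [Pi.zero_apply, pow_zero, Finset.prod_const_one, mul_one]
      exact congrArg (u * ·) (Finset.prod_congr rfl fun i _ => by rw [hsk i])
    obtain ⟨X, hXi, hXn, σ, hσ, C, x, hchain, hσx, hxcl, hclean⟩ :=
      exists_pointChain_cleanPermissibleAt hX₀ hC₀reg hx₀ hx₀C hdim₀ p G cc hcc w u hw hu c2 hc2 hc2P 0 γ π hγ hπ k a
        (Or.inr hdiv) hX'
    exact ⟨X, hXi, hXn, σ, hσ, C, x, _, hchain, hσx, hxcl, hclean⟩

end Summit.ResolutionOfSingularities.ResolutionOfSingularities.Theorems.RadicialJung.CleanModels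

end
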